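import Summits.QuantumFields.YangMills.Theorems.BalabanLadderUVSeamRecClassicalResponseThermalFloorOneLink
import Summits.QuantumFields.YangMills.Theorems.BalabanLadderUVSeamRecClassicalResponseSemiclassical
import Literature.MathematicalPhysics.QuantumFieldTheory.LatticeGaugeDobrushinPoincare
import Literature.MathematicalPhysics.QuantumFieldTheory.LatticeGaugeShenZhuZhuProofs
import Literature.Geometry.GaugeTheory.SpinorAlgebraFour
import HarnessLib

/-!
# Crux `UVSeamRec` (stmt-QuantumFields-20043): the THERMAL FLOOR of the centre plaquette in every `SU(2)` cube kernel —
# no exterior freezes a plaquette faster than `1/β`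

Helper file (`--supports stmt-QuantumFields-20043`) of the LEAD seat `ym-spine-20043-p1` (gen 10), part 2 of the «thermal floor» files; sequel of
`…ClassicalResponseThermalFloorOneLink` (the one-link plaquette floor `E_ν[2 − Re tr(gW)] ≥ 6/(4B+3)` for every `W ∈ SU(2)` under every one-link law
`∝ e^{B Re tr(gV)}`).  Part 3 (`…ThermalFloorSplit`) draws the consequence for the flag-free classical split.

WHAT IS PROVED.
* §3 `exists_stapleSum_eq_smul` — the staple sum of a link in an `SU(2)` configuration is `s·V` with `V ∈ SU(2)`, `0 ≤ s ≤ #{p ∋ e}` (sums of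
  `SU(2)` matrices are quaternions: tree `quatMatrix`, `su2Quat`).
* §4 `integral_ymSpecification_singleton` (any `G`, `ρ`: the one-link kernel as a ratio of tilted Haar integrals, the tree's `integral_ymSpecification`
  with gluing = `update`; adapted from 19353's `kernel_linkAction_eq_div`), and **`kernel_plaquetteDeficit_ge`**: for `SU(2)` in the fundamental
  representation, every `β ≥ 0`, every link `e`, EVERY exterior `ω` and every plaquette `p ∋ e`:  `6/(4β·#{p' ∋ e} + 3) ≤ ∫ (2 − Re tr U_p) dγ_{e}(U | ω)`
  (part 1's one-link floor with `B = βs ≤ β·#{p' ∋ e}`; `Re tr U_p(ω^{e←g}) = Re tr(g·staple_p)`, tree `re_trace_holonomy_update`).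
* §5 **`kernel_plaquetteDeficit_ge_of_mem`** — the same floor inside EVERY finite-volume kernel `γ_Λ(· | η)` with `e ∈ Λ` (consistency
  `γ_Λ γ_{e} = γ_Λ` of the tree's specification, as in 19353's `kernel_linkAction_ge_of_mem`), and in the crux letters **`kerE_deficit_ge`**: in `d = 4`,
  `6/(24β + 3) ≤ kerE_{SU(2), rF, β}^{η}(x − (R+1), 2R+3)(2 − plane q x)` for ALL `β ≥ 0`, `R`, `q` (`q.1 < q.2`), `x`, `η` — no boundary condition, in
  particular not the identity exterior of tempered-d1's Dirichlet rate law, freezes the centre plaquette of a cube faster than `1/β`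
  (the plaquette-level, `SU(2)` twin of 19353's link-action floor `kernel_linkAction_ge_of_mem`).

HONEST FRAMING.  One-link (heat-bath) algebra + DLR consistency; an equipartition-type FLOOR, perturbatively visible (tree level `3/(4β)`), constants not
sharp; nothing of E0′, NT or the gap; not Clay.
-/

set_option autoImplicit false

noncomputable section

open scoped Matrix
open MeasureTheory Filter Topology ProbabilityTheory
open Literature.MathematicalPhysics.QuantumFieldTheory (LatticeRep haarProbability staple stapleSum re_trace_holonomy_update
  wilsonBoundaryAction_singleton_update card_plaquettesTouching_singleton_le plaquetteEdges_eq plaqLink1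
  isSpecification_ymSpecification_of_t2Space mem_plaquettesTouching_singleton)
open Literature.MathematicalPhysics.QuantumLattice (LGConfig ZdEdge ZdPlaquette ymSpecification wilsonBoundaryAction plaquettesTouching
  plaquetteEdges plaquetteHolonomyZd quatMatrix su2Quat quatMatrix_su2Quat norm_su2Quat quatMatrix_smul quatMatrix_mem_specialUnitaryGroup
  integral_ymSpecification isProbabilityMeasure_ymSpecification continuous_wilsonBoundaryAction continuous_integral_ymSpecification
  abs_integral_ymSpecification_le fundamentalRep fundamentalRep_apply fundamentalRep_mem_unitaryGroup fundamentalLatticeRep)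
open Literature.Probability.LatticeModels (glueWith glueWith_apply_mem glueWith_apply_not_mem IsSpecification)
open Summit.QuantumFields.YangMills.Cruxes.OSLegsFromFemtoAndGap.DlrCollarTransfer
open Summit.QuantumFields.YangMills.Cruxes.NT.BoundaryLaw (plane_eq_plaquetteObs)
open Literature.Geometry.GaugeTheory (quatMatrix_add quatMatrix_zero)

namespace Summit.QuantumFields.YangMills.Cruxes.UVSeamRec.ClassicalResponse.ThermalFloor

/-! ## §3 The staple sum of an `SU(2)` link is a non-negative multiple of an `SU(2)` matrix -/

/-- **Polar form of the staple sum**: for every link `e` of `ℤ^d` and every `SU(2)` configuration `ω` there are `s ∈ [0, #{p ∋ e}]` and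
`V ∈ SU(2)` with `Σ_{p ∋ e} staple_p^e(ω) = s·V` (a sum of `k` unit quaternions is a quaternion of norm `≤ k`). [folklore] -/
theorem exists_stapleSum_eq_smul {d : ℕ} [DecidableEq (ZdEdge d)] (e : ZdEdge d)
    (ω : LGConfig d (Matrix.specialUnitaryGroup (Fin 2) ℂ)) :
    ∃ (s : ℝ) (V : Matrix.specialUnitaryGroup (Fin 2) ℂ), 0 ≤ s ∧ s ≤ (plaquettesTouching {e}).card ∧
      stapleSum e ω = (s : ℂ) • (V : Matrix (Fin 2) (Fin 2) ℂ) := by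
  classical
  set Q : Quaternion ℝ := ∑ p ∈ plaquettesTouching {e}, su2Quat (staple p e ω) with hQ
  -- `quatMatrix` is additive (tree `quatMatrix_add/zero`), hence commutes with the finite sum of staples
  let φ : Quaternion ℝ →+ Matrix (Fin 2) (Fin 2) ℂ :=
    { toFun := quatMatrix, map_zero' := quatMatrix_zero, map_add' := quatMatrix_add }
  have hS : stapleSum e ω = quatMatrix Q := by
    have hsum : quatMatrix Q = ∑ p ∈ plaquettesTouching {e}, quatMatrix (su2Quat (staple p e ω)) := map_sum φ _ _
    rw [hsum]
    unfold stapleSum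
    exact Finset.sum_congr rfl fun p _ => (quatMatrix_su2Quat _).symm
  have hnorm : ‖Q‖ ≤ (plaquettesTouching {e}).card := by
    rw [hQ]
    refine (norm_sum_le _ _).trans ?_
    rw [Finset.sum_congr rfl fun p _ => norm_su2Quat (staple p e ω), Finset.sum_const, nsmul_eq_mul, mul_one]
  by_cases hQ0 : Q = 0
  · refine ⟨0, 1, le_rfl, by positivity, ?_⟩
    rw [hS, hQ0, quatMatrix_zero, Complex.ofReal_zero, zero_smul]
  · have hQpos : 0 < ‖Q‖ := norm_pos_iff.2 hQ0
    set u : Quaternion ℝ := ‖Q‖⁻¹ • Q with hu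
    have hun : ‖u‖ = 1 := by
      rw [hu, norm_smul, norm_inv, norm_norm, inv_mul_cancel₀ hQpos.ne']
    refine ⟨‖Q‖, ⟨quatMatrix u, quatMatrix_mem_specialUnitaryGroup hun⟩, norm_nonneg _, hnorm, ?_⟩
    rw [hS]
    have hQu : Q = ‖Q‖ • u := by rw [hu, smul_smul, mul_inv_cancel₀ hQpos.ne', one_smul]
    conv_lhs => rw [hQu]
    rw [quatMatrix_smul]

/-! ## §4 The one-link kernel: ratio form, and the plaquette floor for `SU(2)` -/

section OneLink

variable {G : Type*} [Group G] [TopologicalSpace G] [IsTopologicalGroup G] [CompactSpace G]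
  [MeasurableSpace G] [BorelSpace G] [SecondCountableTopology G] {N : ℕ} (ρ : G →* Matrix (Fin N) (Fin N) ℂ)

/-- **The one-link kernel as a ratio of tilted Haar integrals** (general observable): for a measurable `F`,
`∫ F dγ_{e}(· | ω) = (∫ F(ω^{e←g}) e^{−β S_e(ω^{e←g})} dg) / (∫ e^{−β S_e(ω^{e←g})} dg)` — the tree's `integral_ymSpecification` on the one-point
index set, where gluing is `update ω e ∘ eval` (adapted from 19353's `kernel_linkAction_eq_div`). [folklore] -/
theorem integral_ymSpecification_singleton {d : ℕ} [DecidableEq (ZdEdge d)] (hρ : Continuous ρ) (β : ℝ) (e : ZdEdge d)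
    (ω : LGConfig d G) {F : LGConfig d G → ℝ} (hF : Measurable F) :
    ∫ U, F U ∂(ymSpecification ρ β {e} ω) =
      (∫ g, F (Function.update ω e g) * Real.exp (-β * wilsonBoundaryAction ρ {e} (Function.update ω e g)) ∂(haarProbability G)) /
        ∫ g, Real.exp (-β * wilsonBoundaryAction ρ {e} (Function.update ω e g)) ∂(haarProbability G) := by
  rw [integral_ymSpecification ρ hρ β {e} hF ω]
  set ev : (↥({e} : Finset (ZdEdge d)) → G) → G := fun ζ => ζ ⟨e, Finset.mem_singleton_self e⟩ with hev
  have hgl : ∀ ζ : ↥({e} : Finset (ZdEdge d)) → G, glueWith {e} ζ ω = Function.update ω e (ev ζ) := by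
    intro ζ
    funext z
    by_cases hz : z = e
    · subst hz; simp [hev]
    · rw [Function.update_of_ne hz, glueWith_apply_not_mem _ _ _ (by simpa using hz)]
  have hmap : (Measure.pi fun _ : ↥({e} : Finset (ZdEdge d)) => haarProbability G).map ev = haarProbability G :=
    (MeasureTheory.measurePreserving_eval (fun _ : ↥({e} : Finset (ZdEdge d)) => haarProbability G)
      ⟨e, Finset.mem_singleton_self e⟩).map_eq
  have hevm : Measurable ev := measurable_pi_apply _
  set F₁ : G → ℝ := fun g => F (Function.update ω e g) * Real.exp (-β * wilsonBoundaryAction ρ {e} (Function.update ω e g)) with hF₁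
  set F₂ : G → ℝ := fun g => Real.exp (-β * wilsonBoundaryAction ρ {e} (Function.update ω e g)) with hF₂
  set π : Measure (↥({e} : Finset (ZdEdge d)) → G) := Measure.pi fun _ => haarProbability G with hπ
  have e1 : (fun ζ : ↥({e} : Finset (ZdEdge d)) → G =>
      F (glueWith {e} ζ ω) * Real.exp (-β * wilsonBoundaryAction ρ {e} (glueWith {e} ζ ω))) = fun ζ => F₁ (ev ζ) := by
    funext ζ; simp only [hF₁, hgl]
  have e2 : (fun ζ : ↥({e} : Finset (ZdEdge d)) → G => Real.exp (-β * wilsonBoundaryAction ρ {e} (glueWith {e} ζ ω))) =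
      fun ζ => F₂ (ev ζ) := by
    funext ζ; simp only [hF₂, hgl]
  have hupd : Measurable fun g : G => Function.update ω e g := by
    refine measurable_pi_lambda _ fun z => ?_
    by_cases hz : z = e
    · subst hz
      simp only [Function.update_self]
      exact measurable_id
    · simp only [Function.update_of_ne hz]; exact measurable_const
  have hSm : Measurable fun g : G => wilsonBoundaryAction ρ {e} (Function.update ω e g) :=
    (continuous_wilsonBoundaryAction ρ hρ {e}).measurable.comp hupd
  have hm1 : AEStronglyMeasurable F₁ (π.map ev) :=
    ((hF.comp hupd).mul (Real.measurable_exp.comp (measurable_const.mul hSm))).aestronglyMeasurable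
  have hm2 : AEStronglyMeasurable F₂ (π.map ev) := (Real.measurable_exp.comp (measurable_const.mul hSm)).aestronglyMeasurable
  have H1 : ∫ ζ, F₁ (ev ζ) ∂π = ∫ g, F₁ g ∂(haarProbability G) := by
    have h := integral_map (μ := π) hevm.aemeasurable hm1
    rw [hmap] at h
    exact h.symm
  have H2 : ∫ ζ, F₂ (ev ζ) ∂π = ∫ g, F₂ g ∂(haarProbability G) := by
    have h := integral_map (μ := π) hevm.aemeasurable hm2
    rw [hmap] at h
    exact h.symm
  rw [e1, e2, H1, H2]

end OneLink

/-- The real trace of the product of the underlying matrices of `g, W ∈ SU(2)` is `(fundamentalRep g * fundamentalRep W).trace.re`. [folklore] -/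
theorem re_trace_fundamentalRep_mul (g W : Matrix.specialUnitaryGroup (Fin 2) ℂ) :
    ((fundamentalRep (Fin 2) g * fundamentalRep (Fin 2) W).trace).re = ((g.1 * W.1).trace).re := by
  simp only [fundamentalRep_apply]

/-- **PLAQUETTE FLOOR OF THE ONE-LINK KERNEL, UNIFORMLY IN THE EXTERIOR** (`SU(2)`, fundamental representation): for every `β ≥ 0`, every
link `e` of `ℤ^d`, EVERY exterior `ω` and every plaquette `p ∋ e`:
`6/(4β·#{p' ∋ e} + 3) ≤ ∫ (2 − Re tr U_p) dγ_{e}(U | ω)` — the one-link law is `∝ exp(β Re tr(g·S))dg` with `S = s·V` the staple sum (§3),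
`Re tr U_p(ω^{e←g}) = Re tr(g·staple_p)` (tree `re_trace_holonomy_update`), and part 1's one-link floor applies with `B = βs ≤ β·#{p' ∋ e}`.
[folklore] -/
theorem kernel_plaquetteDeficit_ge {d : ℕ} [DecidableEq (ZdEdge d)] {β : ℝ} (hβ : 0 ≤ β) (e : ZdEdge d)
    (ω : LGConfig d (Matrix.specialUnitaryGroup (Fin 2) ℂ)) {p : ZdPlaquette d} (hp : e ∈ plaquetteEdges p) :
    6 / (4 * (β * (plaquettesTouching {e}).card) + 3) ≤
      ∫ U, (2 - ((fundamentalRep (Fin 2) (plaquetteHolonomyZd U p.1 p.2.1.1 p.2.1.2)).trace).re)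
        ∂(ymSpecification (fundamentalRep (Fin 2)) β {e} ω) := by
  have hρ : Continuous (fundamentalRep (Fin 2)) := Literature.MathematicalPhysics.QuantumLattice.continuous_fundamentalRep (Fin 2)
  have hρu := fundamentalRep_mem_unitaryGroup (n := Fin 2)
  -- the observable and the weight after updating the link
  set W : Matrix.specialUnitaryGroup (Fin 2) ℂ := staple p e ω with hW
  obtain ⟨s, V, hs0, hsle, hS⟩ := exists_stapleSum_eq_smul e ω
  have hF : Measurable fun U : LGConfig d (Matrix.specialUnitaryGroup (Fin 2) ℂ) =>
      2 - ((fundamentalRep (Fin 2) (plaquetteHolonomyZd U p.1 p.2.1.1 p.2.1.2)).trace).re :=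
    measurable_const.sub ((Literature.MathematicalPhysics.QuantumLattice.continuous_plaquetteObs _ hρ p.1 p.2.1.1 p.2.1.2).measurable)
  rw [integral_ymSpecification_singleton (fundamentalRep (Fin 2)) hρ β e ω hF]
  have hobs : ∀ g : Matrix.specialUnitaryGroup (Fin 2) ℂ,
      2 - ((fundamentalRep (Fin 2) (plaquetteHolonomyZd (Function.update ω e g) p.1 p.2.1.1 p.2.1.2)).trace).re =
        2 - ((g.1 * W.1).trace).re := by
    intro g
    rw [re_trace_holonomy_update (fundamentalRep (Fin 2)) hρu hp ω g, re_trace_fundamentalRep_mul]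
  have hwt : ∀ g : Matrix.specialUnitaryGroup (Fin 2) ℂ,
      -β * wilsonBoundaryAction (fundamentalRep (Fin 2)) {e} (Function.update ω e g) =
        -(β * (2 * (plaquettesTouching {e}).card)) + (β * s) * ((g.1 * V.1).trace).re := by
    intro g
    rw [wilsonBoundaryAction_singleton_update (fundamentalRep (Fin 2)) hρu e ω g, Finset.sum_sub_distrib, Finset.sum_const,
      nsmul_eq_mul]
    have hsum : ∑ p' ∈ plaquettesTouching {e}, ((fundamentalRep (Fin 2) g * fundamentalRep (Fin 2) (staple p' e ω)).trace).re =
        s * ((g.1 * V.1).trace).re := by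
      simp only [fundamentalRep_apply]
      calc ∑ p' ∈ plaquettesTouching {e}, ((g.1 * (staple p' e ω).1).trace).re
          = ((g.1 * stapleSum e ω).trace).re := by
            unfold stapleSum
            rw [Finset.mul_sum, Matrix.trace_sum, Complex.re_sum]
        _ = s * ((g.1 * V.1).trace).re := by
            rw [hS, Matrix.mul_smul, Matrix.trace_smul, smul_eq_mul, Complex.re_ofReal_mul]
    rw [hsum]
    simp only [Nat.cast_ofNat]
    ring
  simp_rw [hobs, hwt, Real.exp_add]
  -- pull the constant factor out of both integrals and cancel it
  set c : ℝ := Real.exp (-(β * (2 * (plaquettesTouching {e}).card))) with hc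
  have hcpos : 0 < c := Real.exp_pos _
  have hnum : ∫ g : Matrix.specialUnitaryGroup (Fin 2) ℂ, (2 - ((g.1 * W.1).trace).re) * (c * Real.exp (β * s * ((g.1 * V.1).trace).re))
      ∂(haarProbability (Matrix.specialUnitaryGroup (Fin 2) ℂ)) =
      c * ∫ g : Matrix.specialUnitaryGroup (Fin 2) ℂ, (2 - ((g.1 * W.1).trace).re) * Real.exp (β * s * ((g.1 * V.1).trace).re)
      ∂(haarProbability (Matrix.specialUnitaryGroup (Fin 2) ℂ)) := by
    rw [← integral_const_mul]
    refine integral_congr_ae (ae_of_all _ fun g => ?_)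
    ring
  have hden : ∫ g : Matrix.specialUnitaryGroup (Fin 2) ℂ, c * Real.exp (β * s * ((g.1 * V.1).trace).re)
      ∂(haarProbability (Matrix.specialUnitaryGroup (Fin 2) ℂ)) =
      c * ∫ g : Matrix.specialUnitaryGroup (Fin 2) ℂ, Real.exp (β * s * ((g.1 * V.1).trace).re)
      ∂(haarProbability (Matrix.specialUnitaryGroup (Fin 2) ℂ)) := integral_const_mul _ _
  rw [hnum, hden, mul_div_mul_left _ _ hcpos.ne']
  -- positivity of the one-link partition function and part 1's floor
  have hB : 0 ≤ β * s := mul_nonneg hβ hs0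
  have hZpos : 0 < ∫ g : Matrix.specialUnitaryGroup (Fin 2) ℂ, Real.exp (β * s * ((g.1 * V.1).trace).re)
      ∂(haarProbability (Matrix.specialUnitaryGroup (Fin 2) ℂ)) :=
    integral_exp_pos (integrable_of_continuous_su2 (Real.continuous_exp.comp (continuous_const.mul (continuous_re_trace_mul _))))
  rw [le_div_iff₀ hZpos]
  have hmain := integral_two_sub_re_trace_mul_mul_exp_ge hB V W
  -- `6/(4β#P+3) ≤ 6/(4βs+3)` since `s ≤ #P`
  have hmono : 6 / (4 * (β * (plaquettesTouching {e}).card) + 3) ≤ 6 / (4 * (β * s) + 3) := by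
    apply div_le_div_of_nonneg_left (by norm_num) (by positivity)
    nlinarith [mul_le_mul_of_nonneg_left hsle hβ]
  exact (mul_le_mul_of_nonneg_right hmono hZpos.le).trans hmain

/-! ## §5 Inside every finite-volume kernel (consistency), and in the crux letters -/

/-- **The plaquette floor inside every finite-volume kernel** (`SU(2)`, fundamental): for `β ≥ 0`, any finite link set `Λ ∋ e`, any plaquette
`p ∋ e` and EVERY exterior `η`, `6/(4β·#{p' ∋ e} + 3) ≤ ∫ (2 − Re tr U_p) dγ_Λ(U | η)` (consistency `γ_Λ γ_{e} = γ_Λ` of the tree's specification,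
as in 19353's `kernel_linkAction_ge_of_mem`). [folklore] -/
theorem kernel_plaquetteDeficit_ge_of_mem {d : ℕ} [DecidableEq (ZdEdge d)] {β : ℝ} (hβ : 0 ≤ β) (Λ : Finset (ZdEdge d))
    {e : ZdEdge d} (he : e ∈ Λ) {p : ZdPlaquette d} (hp : e ∈ plaquetteEdges p)
    (η : LGConfig d (Matrix.specialUnitaryGroup (Fin 2) ℂ)) :
    6 / (4 * (β * (plaquettesTouching {e}).card) + 3) ≤
      ∫ U, (2 - ((fundamentalRep (Fin 2) (plaquetteHolonomyZd U p.1 p.2.1.1 p.2.1.2)).trace).re)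
        ∂(ymSpecification (fundamentalRep (Fin 2)) β Λ η) := by
  have hρ : Continuous (fundamentalRep (Fin 2)) := Literature.MathematicalPhysics.QuantumLattice.continuous_fundamentalRep (Fin 2)
  have hρu := fundamentalRep_mem_unitaryGroup (n := Fin 2)
  have hγ := isSpecification_ymSpecification_of_t2Space (d := d) (fundamentalRep (Fin 2)) hρ β
  haveI := hγ.isProbability Λ η
  set F : LGConfig d (Matrix.specialUnitaryGroup (Fin 2) ℂ) → ℝ :=
    fun U => 2 - ((fundamentalRep (Fin 2) (plaquetteHolonomyZd U p.1 p.2.1.1 p.2.1.2)).trace).re with hFdef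
  have hFc : Continuous F :=
    continuous_const.sub (Literature.MathematicalPhysics.QuantumLattice.continuous_plaquetteObs _ hρ p.1 p.2.1.1 p.2.1.2)
  have hFm : Measurable F := hFc.measurable
  have hFC : ∀ U, |F U| ≤ 4 := by
    intro U
    have h := Literature.MathematicalPhysics.QuantumLattice.abs_plaquetteObs_le_holds (fundamentalRep (Fin 2)) hρu
      p.1 p.2.1.1 p.2.1.2 U
    unfold Literature.MathematicalPhysics.QuantumLattice.plaquetteObs at h
    simp only [hFdef]
    rw [abs_le] at h ⊢
    constructor <;> push_cast at h ⊢ <;> linarith [h.1, h.2]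
  -- consistency in integral form
  let κ : ProbabilityTheory.Kernel (LGConfig d (Matrix.specialUnitaryGroup (Fin 2) ℂ)) (LGConfig d (Matrix.specialUnitaryGroup (Fin 2) ℂ)) :=
    ⟨ymSpecification (fundamentalRep (Fin 2)) β {e}, hγ.measurable_fun _⟩
  have hsub : ({e} : Finset (ZdEdge d)) ⊆ Λ := Finset.singleton_subset_iff.2 he
  have hbind : (ymSpecification (fundamentalRep (Fin 2)) β Λ η).bind (ymSpecification (fundamentalRep (Fin 2)) β {e}) =
      ymSpecification (fundamentalRep (Fin 2)) β Λ η := by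
    ext B hB
    rw [Measure.bind_apply hB (hγ.measurable_fun _).aemeasurable]
    exact hγ.consistent hsub η B hB
  have hcomp : (κ ∘ₖ ProbabilityTheory.Kernel.const Unit (ymSpecification (fundamentalRep (Fin 2)) β Λ η)) () =
      ymSpecification (fundamentalRep (Fin 2)) β Λ η := by
    rw [ProbabilityTheory.Kernel.comp_apply, ProbabilityTheory.Kernel.const_apply]
    exact hbind
  have hfi : Integrable F ((κ ∘ₖ ProbabilityTheory.Kernel.const Unit (ymSpecification (fundamentalRep (Fin 2)) β Λ η)) ()) := by
    rw [hcomp]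
    exact Integrable.of_mem_Icc (-4) 4 hFm.aemeasurable (ae_of_all _ fun U => abs_le.1 (hFC U))
  have key := ProbabilityTheory.Kernel.integral_comp hfi
  rw [hcomp, ProbabilityTheory.Kernel.const_apply] at key
  rw [key]
  have hpt : ∀ ζ : LGConfig d (Matrix.specialUnitaryGroup (Fin 2) ℂ),
      6 / (4 * (β * (plaquettesTouching {e}).card) + 3) ≤ ∫ U, F U ∂(κ ζ) := fun ζ => kernel_plaquetteDeficit_ge hβ e ζ hp
  have hcont : Continuous fun ζ : LGConfig d (Matrix.specialUnitaryGroup (Fin 2) ℂ) => ∫ U, F U ∂(κ ζ) :=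
    continuous_integral_ymSpecification (fundamentalRep (Fin 2)) hρ β {e} hFc hFC
  have hint : Integrable (fun ζ : LGConfig d (Matrix.specialUnitaryGroup (Fin 2) ℂ) => ∫ U, F U ∂(κ ζ))
      (ymSpecification (fundamentalRep (Fin 2)) β Λ η) :=
    Integrable.of_mem_Icc (-4) 4 hcont.measurable.aemeasurable
      (ae_of_all _ fun ζ => abs_le.1 (abs_integral_ymSpecification_le (fundamentalRep (Fin 2)) hρ β {e} hFC ζ))
  calc 6 / (4 * (β * (plaquettesTouching {e}).card) + 3)
      = ∫ _ζ, 6 / (4 * (β * (plaquettesTouching {e}).card) + 3) ∂(ymSpecification (fundamentalRep (Fin 2)) β Λ η) := by simp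
    _ ≤ _ := integral_mono (integrable_const _) hint hpt

/-- The first link `(x, q.1)` of the plaquette `(x, q)` lies on it. [folklore] -/
theorem mem_plaquetteEdges_fst (x : Fin 4 → ℤ) (q : Fin 4 × Fin 4) (hq : q.1 < q.2) :
    ((x, q.1) : ZdEdge 4) ∈ plaquetteEdges ((x, ⟨q, hq⟩) : ZdPlaquette 4) := by
  rw [plaquetteEdges_eq]
  exact Finset.mem_insert_self _ _

/-- The first link `(x, q.1)` of the centre plaquette is an interior link of the cube of side `2R+3` based at `x − (R+1)`. [folklore] -/
theorem fst_mem_cubeEdges (R : ℕ) (x : Fin 4 → ℤ) (q : Fin 4 × Fin 4) :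
    ((x, q.1) : ZdEdge 4) ∈ cubeEdges (fun k => x k - (R + 1)) (2 * R + 3) := by
  unfold cubeEdges cubeSites
  simp only [Finset.mem_filter, Finset.mem_product, Finset.mem_univ, and_true, Fintype.mem_piFinset, Finset.mem_Ico,
    Pi.add_apply, Pi.single_apply]
  refine ⟨fun j => ?_, fun j => ?_⟩
  · push_cast; constructor <;> omega
  · split_ifs <;> push_cast <;> constructor <;> omega

/-- **THE THERMAL FLOOR IN THE CRUX LETTERS** (`SU(2)`, fundamental representation, `d = 4`): for ALL `β ≥ 0`, `R`, orientations `q.1 < q.2`,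
sites `x` and exteriors `η`,  `6/(24β + 3) ≤ kerE^η_β(cube of side 2R+3 around x)(2 − plane q x)` — no boundary condition freezes the centre
plaquette faster than `1/β` (`#{p' ∋ e} ≤ 6` in four dimensions). [folklore] -/
theorem kerE_deficit_ge {β : ℝ} (hβ : 0 ≤ β) (R : ℕ) (q : Fin 4 × Fin 4) (hq : q.1 < q.2) (x : Fin 4 → ℤ)
    (η : LGConfig 4 (Matrix.specialUnitaryGroup (Fin 2) ℂ)) :
    6 / (24 * β + 3) ≤ kerE (Matrix.specialUnitaryGroup (Fin 2) ℂ) (fundamentalLatticeRep 2) β (fun k => x k - (R + 1)) (2 * R + 3) η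
      (fun U => 2 - plane (Matrix.specialUnitaryGroup (Fin 2) ℂ) (fundamentalLatticeRep 2) q x U) := by
  classical
  have h := kernel_plaquetteDeficit_ge_of_mem hβ (cubeEdges (fun k => x k - (R + 1)) (2 * R + 3)) (fst_mem_cubeEdges R x q)
    (mem_plaquetteEdges_fst x q hq) η
  have hcard : ((plaquettesTouching ({((x, q.1) : ZdEdge 4)} : Finset (ZdEdge 4))).card : ℝ) ≤ 6 := by
    exact_mod_cast card_plaquettesTouching_singleton_le ((x, q.1) : ZdEdge 4)
  have hmono : 6 / (24 * β + 3) ≤ 6 / (4 * (β * (plaquettesTouching ({((x, q.1) : ZdEdge 4)} : Finset (ZdEdge 4))).card) + 3) := by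
    apply div_le_div_of_nonneg_left (by norm_num) (by positivity)
    nlinarith [mul_le_mul_of_nonneg_left hcard hβ]
  refine hmono.trans (h.trans_eq ?_)
  unfold kerE
  refine integral_congr_ae (ae_of_all _ fun U => ?_)
  simp only [plane_eq_plaquetteObs, Literature.MathematicalPhysics.QuantumLattice.plaquetteObs]
  rfl

end Summit.QuantumFields.YangMills.Cruxes.UVSeamRec.ClassicalResponse.ThermalFloor

end
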